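import Mathlib.Analysis.Calculus.Deriv.Basic
import Mathlib.Topology.Order.Basic
import Mathlib.Tactic
import Literature.Analysis.ODE.ComplexSecondOrder

/-!
# Tearing modes: the outer-region (ideal, marginal) equations and the stability index `Δ′`, as printed

Topic `Literature/MathematicalPhysics/MHD` (namespace `Literature.MathematicalPhysics.MHD`, sub-namespace
`Tearing`). The OBJECTS of linear resistive tearing-mode theory that live in the ideal outer region —
typed as printed, no layer physics:

* `Tearing.IsSlabOuterSolution` — slab sheet pinch: `B₁ₓ″ − (k² + F″/F) B₁ₓ = 0`
  [cite: Schnack2009, Lect. 34 eq. (34.8)/(34.11) pp. 206–207], [cite: Miyamoto2007, §9.1 eq. (9.15) p. 222],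
  REUSING the tree's `Literature.Analysis.ODE.IsSol2`;
* `Tearing.CylProfile`, `Tearing.IsCylOuterSolution` — straight tokamak, marginal (`γ → 0`):
  `∇²ψ + (m μ₀ j′/(r F)) ψ = 0`, `F = (B_θ/r)(n q − m)` [cite: Miyamoto2007, §9.4.1 eq. (9.61) p. 237];
  `Tearing.IsCylOuterSolutionP` — the cylindrical Newcomb equation with pressure
  [cite: HamEtAl2013, §4];
* `Tearing.IsDeltaPrime ψ ψ' r_s Δ′` — `Δ′ := lim_{ε→0⁺} [ψ′(r_s+ε) − ψ′(r_s−ε)]/ψ(r_s)`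
  [cite: Schnack2009, eq. (34.13) p. 207], [cite: Miyamoto2007, eq. (9.16) p. 222],
  [cite: Bateman1978, §10.2 eq. (10.2.9) p. 200]; uniqueness and the one-sided-limit formula (proved).

The CRITERION («instability iff `Δ′ > 0`», Furth–Killeen–Rosenbluth 1963, [cite: Schnack2009, eq. (34.15)])
is a statement about growth rates of the matched problem and is NOT asserted here (it is the named fact
of the lit-3 register row A11); this file supplies the objects it talks about. Deliberately not here:
inner-layer equations and growth-rate scalings, the finite-pressure GGJ threshold `Δ′_c > 0`
[cite: HamEtAl2013, §1], toroidal `Δ′` matrices. Written for LADDER-GRIDFUSION rung F3 (model row 6).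
-/

noncomputable section

open Set Filter
open scoped Topology

namespace Literature.MathematicalPhysics.MHD

namespace Tearing

/-- **Slab outer-region (ideal, marginal) tearing equation**, as printed: away from the resonant plane
`x = 0` (where `F = k·B₀ = 0`) the perturbed normal field `ψ = B₁ₓ` satisfies
`ψ″ − (k² + F″/F) ψ = 0` [cite: Schnack2009, Lect. 34 eq. (34.8)/(34.11) p. 206–207],
[cite: Miyamoto2007, §9.1 eq. (9.15) p. 222] (there `F = k·B₀`, `k² = k_y² + k_z²`).
Typed by REUSING the tree's solution predicate `Literature.Analysis.ODE.IsSol2 Q ψ ψ′ s` for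
`ψ″ = Q ψ` with `Q = k² + F″/F`, on a set `s` not containing the zeros of `F`.
Model: incompressible resistive-MHD slab, inertia neglected outside the layer. -/
def IsSlabOuterSolution (F F'' : ℝ → ℝ) (k : ℝ) (ψ ψ' : ℝ → ℝ) (s : Set ℝ) : Prop :=
  Literature.Analysis.ODE.IsSol2 (fun x ↦ k ^ 2 + F'' x / F x) ψ ψ' s

/-- Equilibrium profile data of a **cylindrical (straight-tokamak) plasma** entering the printed
marginal outer equation: poloidal field `B_θ(r)`, safety factor `q(r)`, radial derivative `j′(r)` of
the axial current density, and the constant `μ₀` (reduced, tokamak-ordered data; the full screw-pinch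
profile with Newcomb's `f, g` is `Literature.MathematicalPhysics.MHD.ScrewPinch.Profile`,
filed separately). Model: circular cylinder, periodicity length `2πR`
[cite: Miyamoto2007, §9.4.1 eqs. (9.59)–(9.61) p. 237]. -/
structure CylProfile where
  /-- poloidal magnetic field `B_θ(r)` -/
  Bθ : ℝ → ℝ
  /-- safety factor `q(r)` -/
  q : ℝ → ℝ
  /-- `dj_z/dr`, radial derivative of the axial current density -/
  djdr : ℝ → ℝ
  /-- vacuum permeability `μ₀` (kept symbolic; set to `1` in normalised units) -/
  mu0 : ℝ

namespace CylProfile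

/-- `F(r) = k·B = (B_θ/r)(n q(r) − m)` as printed [cite: Miyamoto2007, §9.4.1 after eq. (9.60) p. 237]
(sign convention of that source; only `F = 0 ⇔ q = m/n` and the product `F·(…)` matter below). -/
def F (P : CylProfile) (m n : ℤ) (r : ℝ) : ℝ := P.Bθ r / r * ((n : ℝ) * P.q r - (m : ℝ))

/-- `r_s` is a **rational (resonant) surface** of the mode `(m,n)`: `q(r_s) = m/n`, i.e. `F(r_s) = 0`
for `B_θ(r_s) ≠ 0` [cite: Miyamoto2007, §9.1 p. 224 («rational surfaces satisfying q(r_s) = m/n»)]. -/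
def IsRationalSurface (P : CylProfile) (m n : ℤ) (rs : ℝ) : Prop :=
  0 < rs ∧ (n : ℝ) * P.q rs = (m : ℝ)

end CylProfile

/-- **Cylindrical outer-region (ideal, marginal `γ → 0`) tearing / kink equation**, as printed:
`∇²ψ + (m μ₀/F)(j′/r) ψ = 0` with `∇²ψ = ψ″ + ψ′/r − (m²/r²)ψ` and `F = (B_θ/r)(nq − m)`
[cite: Miyamoto2007, §9.4.1 eq. (9.61) p. 237] (the `γ² → 0` limit of (9.61); since
`m/(nq − m) = −1/(1 − nq/m)` this is `(1/r)(rψ′)′ − (m²/r²)ψ − μ₀ j′ψ/(B_θ(1 − nq/m)) = 0`). Written as the first-order system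
`ψ′ = ψ'`, `(ψ')′ = −ψ'/r + (m²/r² − m μ₀ j′/(r F)) ψ` at every point of `s` (a set avoiding `r = 0`
and the rational surfaces). Model: zero-β reduced MHD, single helicity, straight tokamak. -/
def IsCylOuterSolution (P : CylProfile) (m n : ℤ) (ψ ψ' : ℝ → ℝ) (s : Set ℝ) : Prop :=
  ∀ r ∈ s, HasDerivAt ψ (ψ' r) r ∧
    HasDerivAt ψ' (-(ψ' r) / r + (((m : ℝ) ^ 2) / r ^ 2
      - (m : ℝ) * P.mu0 * P.djdr r / (r * P.F m n r)) * ψ r) r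

/-- **Cylindrical outer equation WITH pressure (large-aspect-ratio toroidal curvature folded in)**, as
printed by Ham–Connor–Cowley–Hastie–Hender–Liu: `(r ψ′)′ − (m²/r) ψ − (m q σ′/(m − n q)) ψ
− (2p′/B₀²)(m²(1 − q²)/(m − n q)²) ψ = 0`, `σ = J_∥/B` [cite: HamEtAl2013, §4 (the Newcomb equation
integrated numerically), arXiv:1308.2070 p. 9]. First-order form on a set `s` avoiding `r = 0` and
`q = m/n`. Model: the `(1 − q²)` factor is the printed large-aspect-ratio substitute for average
toroidal curvature («`p′ → p′(1 − q²)`», ibid.); at a rational surface with `p′ ≠ 0` the solutions carry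
the Mercier indices and `Δ′` needs the large/small-solution normalisation (the large/small-solution split of [cite: HamEtAl2013, §2]),
which this predicate does not fix. -/
def IsCylOuterSolutionP (q dσdr dpdr : ℝ → ℝ) (B0 : ℝ) (m n : ℤ) (ψ ψ' : ℝ → ℝ) (s : Set ℝ) :
    Prop :=
  ∀ r ∈ s, HasDerivAt ψ (ψ' r) r ∧
    HasDerivAt (fun ρ ↦ ρ * ψ' ρ)
      ((((m : ℝ) ^ 2) / r + (m : ℝ) * q r * dσdr r / ((m : ℝ) - (n : ℝ) * q r)
        + 2 * dpdr r / B0 ^ 2 * (((m : ℝ) ^ 2 * (1 - q r ^ 2)) / ((m : ℝ) - (n : ℝ) * q r) ^ 2))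
        * ψ r) r

/-- **The tearing stability index `Δ′`** of an outer solution `ψ` (with derivative function `ψ'`) at
the resonant surface `r_s`, as printed: `Δ′ ≡ [ψ′(r_s + ε) − ψ′(r_s − ε)]/ψ(r_s)`
[cite: Schnack2009, Lect. 34 eq. (34.13) p. 207], [cite: Miyamoto2007, §9.1 eq. (9.16) p. 222],
[cite: Bateman1978, §10.2 eq. (10.2.9) p. 200], with the outer limit `ε → 0⁺` made explicit
(the printed `±ε` is the layer edge, sent to zero on the outer scale). The symmetric difference is
essential: for a generic profile `ψ′` itself diverges logarithmically at `r_s` («`B₁ₓ` has logarithmic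
singularity at `x = 0` since `F″/F ∝ 1/x`», [cite: Miyamoto2007, §9.1 after eq. (9.17) p. 223]) while
the two-sided jump converges. `ψ` is required continuous and non-zero at `r_s` («`B₁ₓ` is continuous
at `x = 0`», [cite: Schnack2009, p. 207]). Model: constant-ψ ordering. -/
def IsDeltaPrime (ψ ψ' : ℝ → ℝ) (rs Δ' : ℝ) : Prop :=
  ContinuousAt ψ rs ∧ ψ rs ≠ 0 ∧
    Tendsto (fun ε : ℝ ↦ (ψ' (rs + ε) - ψ' (rs - ε)) / ψ rs) (𝓝[>] (0 : ℝ)) (𝓝 Δ')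

/-- `Δ′` is unique when it exists (limits in `ℝ` are unique): the printed `Δ′` is a well-defined
number [cite: Schnack2009, Lect. 34 eq. (34.13) p. 207]. -/
theorem IsDeltaPrime.unique {ψ ψ' : ℝ → ℝ} {rs Δ₁ Δ₂ : ℝ} (h₁ : IsDeltaPrime ψ ψ' rs Δ₁)
    (h₂ : IsDeltaPrime ψ ψ' rs Δ₂) : Δ₁ = Δ₂ := tendsto_nhds_unique h₁.2.2 h₂.2.2

/-- If `ψ'` has one-sided limits `L₊` at `r_s⁺` and `L₋` at `r_s⁻` (the non-logarithmic case, e.g.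
`j′(r_s) = 0` or the slab benchmarks), then `Δ′ = (L₊ − L₋)/ψ(r_s)` — the printed form
`Δ′ = (B′(r_s+ε) − B′(r_s−ε))/B(r_s)` read literally [cite: Bateman1978, §10.2 eq. (10.2.9) p. 200]. -/
theorem isDeltaPrime_of_oneSided {ψ ψ' : ℝ → ℝ} {rs Lp Lm : ℝ} (hc : ContinuousAt ψ rs)
    (h0 : ψ rs ≠ 0) (hp : Tendsto ψ' (𝓝[>] rs) (𝓝 Lp)) (hm : Tendsto ψ' (𝓝[<] rs) (𝓝 Lm)) :
    IsDeltaPrime ψ ψ' rs ((Lp - Lm) / ψ rs) := by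
  refine ⟨hc, h0, ?_⟩
  have hplus : Tendsto (fun ε : ℝ ↦ rs + ε) (𝓝[>] (0 : ℝ)) (𝓝[>] rs) := by
    apply tendsto_nhdsWithin_of_tendsto_nhds_of_eventually_within
    · exact ((continuous_const.add continuous_id).tendsto' 0 rs (by simp)).mono_left nhdsWithin_le_nhds
    · filter_upwards [self_mem_nhdsWithin] with ε (hε : 0 < ε)
      exact show rs < rs + ε by linarith
  have hminus : Tendsto (fun ε : ℝ ↦ rs - ε) (𝓝[>] (0 : ℝ)) (𝓝[<] rs) := by
    apply tendsto_nhdsWithin_of_tendsto_nhds_of_eventually_within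
    · exact ((continuous_const.sub continuous_id).tendsto' 0 rs (by simp)).mono_left nhdsWithin_le_nhds
    · filter_upwards [self_mem_nhdsWithin] with ε (hε : 0 < ε)
      exact show rs - ε < rs by linarith
  exact ((hp.comp hplus).sub (hm.comp hminus)).div_const _

/-! ### `Δ′` from the resonant (logarithmic) Frobenius representation

At a rational surface with a simple zero of `F` (`q′(r_s) ≠ 0`) the marginal outer equation has indicial
exponents `{0, 1}` in `x = r − r_s`: the SMALL solution `ψ_s = x + …` is analytic, the LARGE one is
`ψ_L = κ ψ_s log|x| + η` with `η` analytic, `η(0) ≠ 0` («`B₁ₓ` has logarithmic singularity at `x = 0`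
since `F″/F ∝ 1/x`» [cite: Miyamoto2007, §9.1 after eq. (9.17) p. 223]; Frobenius structure:
Coddington–Levinson, *Theory of ODE* (1955) Ch. 4 §8). An outer solution is `A ψ_L + B_± ψ_s` on the two
sides (the same `A`, by continuity of `ψ`), and the printed SYMMETRIC jump kills the logarithm:
`Δ′ · ψ(r_s) = (B₊ − B₋) ψ_s′(0)`. The lemma below is the analytic half of that sentence (pure real analysis:
only the behaviour of `ψ_s, η` AT `0` is assumed); existence of the two branches with explicit majorants is
the business of `Literature/Analysis/ODE` (analytic branch: `RegularSingularScalarBranch.lean`).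
-/

/-- **`Δ′` of a log-Frobenius combination.** Suppose that on the punctured neighbourhood `0 < |x| < δ`
of the resonant surface (`x = r − r_s`) an outer solution and its derivative function read
`ψ = A (κ log|x| · ψ_s + η) + B_± ψ_s` and `ψ' = A (κ log|x| · ψ_s' + ζ) + B_± ψ_s'` (`B₊` for `x > 0`,
`B₋` for `x < 0`; `ζ = η′ + κ ψ_s/x` is the regular part of `ψ_L′`), where `ψ_s(0) = 0`, `ψ_s` and
`ψ_s'` are differentiable at `0`, `η` and `ζ` are continuous at `0`, and `ψ(r_s) = A η(0) ≠ 0`. Then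
`ψ` is continuous at `r_s` and `Δ′ = (B₊ − B₋) ψ_s'(0) / (A η(0))` in the printed sense
`Tearing.IsDeltaPrime`: the logarithmic divergence of `ψ′` is even in `x` and cancels in
`ψ′(r_s + ε) − ψ′(r_s − ε)` [cite: Miyamoto2007, §9.1 eqs. (9.16)–(9.17) pp. 222–223],
[cite: Schnack2009, Lect. 34 eq. (34.13) p. 207]. -/
theorem isDeltaPrime_of_logBranch {ψ ψ' ψs ψs' η ζ : ℝ → ℝ} {rs κ A Bp Bm δ s₁ d : ℝ}
    (hδ : 0 < δ) (hs0 : ψs 0 = 0) (hs : HasDerivAt ψs s₁ 0) (hs' : HasDerivAt ψs' d 0)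
    (hη : ContinuousAt η 0) (hζ : ContinuousAt ζ 0) (hA : A * η 0 ≠ 0) (hψ0 : ψ rs = A * η 0)
    (hψp : ∀ x ∈ Ioo 0 δ, ψ (rs + x) = A * (κ * Real.log |x| * ψs x + η x) + Bp * ψs x)
    (hψm : ∀ x ∈ Ioo (-δ) 0, ψ (rs + x) = A * (κ * Real.log |x| * ψs x + η x) + Bm * ψs x)
    (hψ'p : ∀ x ∈ Ioo 0 δ, ψ' (rs + x) = A * (κ * Real.log |x| * ψs' x + ζ x) + Bp * ψs' x)
    (hψ'm : ∀ x ∈ Ioo (-δ) 0, ψ' (rs + x) = A * (κ * Real.log |x| * ψs' x + ζ x) + Bm * ψs' x) :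
    IsDeltaPrime ψ ψ' rs ((Bp - Bm) * ψs' 0 / (A * η 0)) := by
  have hδ' : -δ < 0 := by linarith
  -- `log|x| · x → 0` on both sides of `0`
  have hLp : Tendsto (fun x : ℝ ↦ Real.log |x| * x) (𝓝[>] 0) (𝓝 0) := by
    refine (tendsto_log_mul_rpow_nhdsGT_zero zero_lt_one).congr' ?_
    filter_upwards [self_mem_nhdsWithin] with x _
    rw [Real.rpow_one, Real.log_abs]
  have hLm : Tendsto (fun x : ℝ ↦ Real.log |x| * x) (𝓝[<] 0) (𝓝 0) := by
    refine tendsto_log_mul_self_nhdsLT_zero.congr' ?_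
    filter_upwards [self_mem_nhdsWithin] with x _
    rw [Real.log_abs]
  -- `ψ_s(x)/x → s₁` on the punctured neighbourhood, hence `log|x| · ψ_s(x) → 0` on both sides
  have hslope : Tendsto (fun x : ℝ ↦ x⁻¹ * ψs x) (𝓝[≠] 0) (𝓝 s₁) := by
    simpa only [zero_add, hs0, sub_zero, smul_eq_mul] using hs.tendsto_slope_zero
  have key : ∀ {l : Filter ℝ}, l ≤ 𝓝[≠] (0 : ℝ) → Tendsto (fun x : ℝ ↦ Real.log |x| * x) l (𝓝 0) →
      Tendsto (fun x : ℝ ↦ Real.log |x| * ψs x) l (𝓝 0) := by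
    intro l hl hL
    have h2 : Tendsto (fun x : ℝ ↦ (Real.log |x| * x) * (x⁻¹ * ψs x)) l (𝓝 (0 * s₁)) :=
      hL.mul (hslope.mono_left hl)
    rw [zero_mul] at h2
    refine h2.congr' ?_
    filter_upwards [hl self_mem_nhdsWithin] with x (hx : x ≠ 0)
    field_simp
  have hη' : Tendsto η (𝓝 (0 : ℝ)) (𝓝 (η 0)) := hη.tendsto
  have hs0' : Tendsto ψs (𝓝 (0 : ℝ)) (𝓝 0) := by simpa only [hs0] using hs.continuousAt.tendsto
  have hval0 : A * (κ * 0 + η 0) + Bp * 0 = ψ rs ∧ A * (κ * 0 + η 0) + Bm * 0 = ψ rs := by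
    constructor <;> (rw [hψ0]; ring)
  -- one-sided limits of `ψ` at `r_s`
  have hPsiR : Tendsto (fun x : ℝ ↦ ψ (rs + x)) (𝓝[>] 0) (𝓝 (ψ rs)) := by
    have h1 : Tendsto (fun x : ℝ ↦ A * (κ * (Real.log |x| * ψs x) + η x) + Bp * ψs x) (𝓝[>] 0)
        (𝓝 (A * (κ * 0 + η 0) + Bp * 0)) :=
      ((((key (nhdsGT_le_nhdsNE 0) hLp).const_mul κ).add (hη'.mono_left nhdsWithin_le_nhds)).const_mul
        A).add ((hs0'.mono_left nhdsWithin_le_nhds).const_mul Bp)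
    rw [hval0.1] at h1
    refine h1.congr' ?_
    filter_upwards [Ioo_mem_nhdsGT hδ] with x hx
    rw [hψp x hx]; ring
  have hPsiL : Tendsto (fun x : ℝ ↦ ψ (rs + x)) (𝓝[<] 0) (𝓝 (ψ rs)) := by
    have h1 : Tendsto (fun x : ℝ ↦ A * (κ * (Real.log |x| * ψs x) + η x) + Bm * ψs x) (𝓝[<] 0)
        (𝓝 (A * (κ * 0 + η 0) + Bm * 0)) :=
      ((((key (nhdsLT_le_nhdsNE 0) hLm).const_mul κ).add (hη'.mono_left nhdsWithin_le_nhds)).const_mul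
        A).add ((hs0'.mono_left nhdsWithin_le_nhds).const_mul Bm)
    rw [hval0.2] at h1
    refine h1.congr' ?_
    filter_upwards [Ioo_mem_nhdsLT hδ'] with x hx
    rw [hψm x hx]; ring
  have hcont : ContinuousAt ψ rs := by
    have hc0 : ContinuousAt (fun x : ℝ ↦ ψ (rs + x)) 0 := by
      rw [continuousAt_iff_continuous_left'_right']
      exact ⟨by simpa only [ContinuousWithinAt, add_zero] using hPsiL,
        by simpa only [ContinuousWithinAt, add_zero] using hPsiR⟩
    have heq : ψ = (fun x : ℝ ↦ ψ (rs + x)) ∘ fun r ↦ r - rs := by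
      funext r; simp
    rw [heq]
    exact hc0.comp_of_eq (continuous_id.sub continuous_const).continuousAt (sub_self rs)
  refine ⟨hcont, by rwa [hψ0], ?_⟩
  -- the jump `ψ_s'(ε) − ψ_s'(−ε)` is `O(ε)`, so the logarithm cannot see it
  have hv : HasDerivAt (fun x : ℝ ↦ ψs' x - ψs' (-x)) (d - d * (-1)) 0 := by
    refine hs'.sub ?_
    have hs'' : HasDerivAt ψs' d (-(0 : ℝ)) := by rwa [neg_zero]
    exact hs''.comp (0 : ℝ) (hasDerivAt_neg' (0 : ℝ))
  have hvslope : Tendsto (fun x : ℝ ↦ x⁻¹ * (ψs' x - ψs' (-x))) (𝓝[>] 0) (𝓝 (d - d * (-1))) := by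
    simpa only [zero_add, neg_zero, sub_self, sub_zero, smul_eq_mul] using hv.tendsto_slope_zero_right
  have hT1 : Tendsto (fun x : ℝ ↦ Real.log |x| * (ψs' x - ψs' (-x))) (𝓝[>] 0) (𝓝 0) := by
    have h2 := hLp.mul hvslope
    rw [zero_mul] at h2
    refine h2.congr' ?_
    filter_upwards [self_mem_nhdsWithin] with x (hx : 0 < x)
    field_simp
  have hneg : Tendsto (fun x : ℝ ↦ -x) (𝓝 (0 : ℝ)) (𝓝 0) := continuous_neg.tendsto' (0 : ℝ) 0 neg_zero
  have hζp : Tendsto ζ (𝓝[>] (0 : ℝ)) (𝓝 (ζ 0)) := hζ.tendsto.mono_left nhdsWithin_le_nhds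
  have hζm : Tendsto (fun x : ℝ ↦ ζ (-x)) (𝓝[>] (0 : ℝ)) (𝓝 (ζ 0)) :=
    (hζ.tendsto.comp hneg).mono_left nhdsWithin_le_nhds
  have hs'c : Tendsto ψs' (𝓝[>] (0 : ℝ)) (𝓝 (ψs' 0)) :=
    hs'.continuousAt.tendsto.mono_left nhdsWithin_le_nhds
  have hs'cm : Tendsto (fun x : ℝ ↦ ψs' (-x)) (𝓝[>] (0 : ℝ)) (𝓝 (ψs' 0)) :=
    (hs'.continuousAt.tendsto.comp hneg).mono_left nhdsWithin_le_nhds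
  have hlim : Tendsto (fun ε : ℝ ↦ (A * (κ * (Real.log |ε| * (ψs' ε - ψs' (-ε))) + (ζ ε - ζ (-ε)))
      + (Bp * ψs' ε - Bm * ψs' (-ε))) / ψ rs) (𝓝[>] 0)
      (𝓝 ((A * (κ * 0 + (ζ 0 - ζ 0)) + (Bp * ψs' 0 - Bm * ψs' 0)) / ψ rs)) :=
    ((((hT1.const_mul κ).add (hζp.sub hζm)).const_mul A).add
      ((hs'c.const_mul Bp).sub (hs'cm.const_mul Bm))).div_const _
  have hval : (A * (κ * 0 + (ζ 0 - ζ 0)) + (Bp * ψs' 0 - Bm * ψs' 0)) / ψ rs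
      = (Bp - Bm) * ψs' 0 / (A * η 0) := by
    rw [hψ0]; ring
  rw [← hval]
  refine hlim.congr' ?_
  filter_upwards [Ioo_mem_nhdsGT hδ] with ε hε
  have hεm : -ε ∈ Ioo (-δ) 0 := ⟨by linarith [hε.2], by linarith [hε.1]⟩
  rw [hψ'p ε hε, show rs - ε = rs + -ε by ring, hψ'm (-ε) hεm, abs_neg]
  ring

end Tearing

end Literature.MathematicalPhysics.MHD

end
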